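/-
BALABAN–IMBRIE–JAFFE 1988 (CMP 114), §5.13 p.305–306 [PDF 49–50], display (5.13.3).  The printed display
(p.306, read on the page image; the held text layer p0050 L8–10 is garbled) is the INTEGRATED equation, its left side
carried over from (5.13.1)–(5.13.2):

  «The sum over pairings and the sum over ways of arranging the contractions combine into a sum over walks
   {ω_α}_{α∈π}, ω = (i₁, i₂, …, i_{|ω|}) involving the sites in α, an element of a partition π of Γ. Thus letting 𝒫(Γ)
   denote the partitions of Γ, we have
     ⟨ Π_{i∈I} f(□_i) ⟩_1 = Σ_{Γ⊂I} ∫ ds_Γ Σ_{π∈𝒫(Γ)} ⟨ Π_{α∈π} [ Σ_{ω(α)} ⟨ δ/δΦ, C_s □_{i₁} Δ □_{i₂} C_s □_{i₃} Δ □_{i₄}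
         … Δ □_{i_{|ω(α)|}} C_s ( ½ δ/δΦ + ℱ ) ⟩ ] Π_{i∈I} f(□_i) ⟩_{s_Γ} .                                      (5.13.3)
   The 1/2 for the δ²/δΦ² term compensates for the fact that we count a walk as being different from its reverse.»

EDITORIAL (form of the statement).  What this file proves is the INTEGRAND form of (5.13.3): the identity for the
s_Γ-derivative `∂Γ⟨H⟩(s) = Σ_{π} ⟨ Π_{α∈π}[train_α] H ⟩_s` at a fixed interpolation parameter `s`, i.e. the
expression under `Σ_{Γ⊂I} ∫ ds_Γ` in the printed display; integrating it over `s_Γ` and summing over `Γ ⊂ I` as in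
(5.13.1)–(5.13.2) (`BIJ88PairingAllOrders5133`, `BIJ88CumulantAllOrders5133.dexp`) gives the printed (5.13.3).  The
rendering `∂/∂s_Γ ⟨…⟩_{s_Γ} = Σ_π ⟨…⟩` used in v1.0 of this header and in the docstrings below is therefore a
reshaping of the print, not a quotation.

statement-level skeleton of published theorems with citation tags; proofs where landed; nothing here is a claim
about the Yang–Mills mass gap

PDF held: `paper:balaban1988-cmp114-bij-abelian-higgs-effective-action` (journal page = PDF page + 256).

THE WALK FORM (5.13.3) AT EVERY ORDER, IN THE CORRECTED FORM OF G-C2-24 (the vertices are the blocks `B` of a set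
partition `σ` of `Γ` into singletons and pairs, `BIJ88CumulantAllOrders5133.dexp_eq_sum_smallParts`; the trains run
through these vertices).  Assembling

  * `BIJ88TruncationConnected5133.dexp_eq_sum_connected` — `∂Γ⟨H⟩(s) = Σ_σ (−1)^{|σ|} Σ_z Σ_{connected diagrams}`,
  * `BIJ88ChainRegrouping306.sum_conn_eq_sum_pieces` — connected diagrams = set partitions `P` of the vertex set `σ`
    into groups + one piece (train) per group,
  * `BIJ88TrainPieces306.sum_pieces_eq_trainOp` — the pieces on a group `c`, summed over the sites, act on the smooth
    factor as the train operator `𝕋_c = ∂_{C𝔫(c)ℱ} + ½ Σ_{pq} (C𝔫(c))_{pq} ∂_p∂_q`, `𝔫(c) = Σ_{b∈c} N_b C 𝔫(c∖b)`,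

we obtain `dexp_eq_sum_trains`:

  `∂Γ⟨H⟩(s) = Σ_{σ ∈ smallParts Γ} (−1)^{|σ|} Σ_{P ∈ setPartitions σ} ⟨ (Π_{c∈P} 𝕋_c) H ⟩_s`,

the operator product taken along `P.toList` (`trains`).  Here `C = C_s = (Δ_s-form)⁻¹` (`interpForm`), `ℱ = f`,
`N_b = M_b(s) + M_b(s)ᵀ` with `M_b` the matrix of the vertex `V_B` (`bmat`: `Σ_{l≠i} s_l M^{il}` for `B = {i}`, the
symmetrized `M^{il}` for `B = {i,l}`), and `C𝔫(c)` is the sum over the walks through the vertices of `c` of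
`C N_{b₁} C N_{b₂} ⋯ C N_{b_k} C` — the print's `Σ_{ω_α} C_s □Δ□ C_s ⋯ □Δ□ C_s` with the vertices `□Δ□` replaced by
the corrected vertices of G-C2-24.

## Main statements

* `gexp_add`, `gexp_smul`, `gexp_sum` — linearity of the normalized expectation on integrable factors.
* `sum_pi_insert`, `sum_col_union` — bookkeeping: tuples of pieces over `insert c P`, colourings of a disjoint union.
* `trains`, `trains_mem` — the product of the train operators of a list of groups.
* `sum_pi_pieces_eq_trains` — for pairwise disjoint groups, the tuples of pieces summed over the sites are the
  product of the train operators.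
* `dexp_eq_sum_trains` — **(5.13.3), corrected, at every order.**

## References

* [BalabanImbrieJaffe1988] T. Bałaban, J. Imbrie, A. Jaffe, *Effective action and cluster properties of the abelian
  Higgs model*, Comm. Math. Phys. 114 (1988) 257–315, §5.13 p.305–306.
-/
import Literature.MathematicalPhysics.QuantumFieldTheory.BalabanImbrieJaffe1984to88.BIJ88TrainPieces306

namespace Literature.MathematicalPhysics.QuantumFieldTheory.BalabanImbrieJaffe1984to88.BIJ88WalkForm5133

open MeasureTheory Finset Matrix Function
open scoped BigOperators
open Literature.Probability.LatticeModels (setPartitions IsSetPartition mem_setPartitions colours)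
open Literature.Probability.LatticeModels.LegDiagram (diags mem_diags dval IsConn)
open Literature.MathematicalPhysics.QuantumFieldTheory.Balaban1983to89
open B2Eq228Conditioning (weight source)
open BIJ88DirichletForms305 (interpForm interpForm_posDef)
open BIJ88IntegrationByParts305 (integrable_fieldProd_bdd_tilt)
open BIJ88PairingAllOrders5133 (smallParts mem_smallParts)
open BIJ88WickSource305 (cweight)
open BIJ88WickSourceSmooth305 (dset dset_empty)
open BIJ88CumulantAllOrders5133 (dexp)
open BIJ88TruncationConnected306 (gexp gw gω prod_gw_eq_zero prod_gw_eq)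
open BIJ88TruncationConnected5133 (Leg lvec bmat dexp_eq_sum_connected)
open BIJ88ChainRegrouping306 (pieces mem_pieces sum_conn_eq_sum_pieces)
open BIJ88SmoothClassCalculus306 (Nice IsSmoothClass isSmoothClass_span dset_congr)
open BIJ88TrainPieces306 (col mem_col sum_col_insert lv lvec_eq_lv wker trainOp D2 sum_pieces_eq_trainOp
  piFinset_colours_eq_col mem_plegs_univ)
open BIJ88IbpComponents312 renaming legs → plegs

variable {α I : Type} [Fintype α] [DecidableEq α] [Fintype I] [DecidableEq I]

/-! ## §1  Linearity of the normalized expectation -/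

section Gexp

variable (A : Matrix α α ℝ) (f : α → ℝ)

omit [DecidableEq α] [Fintype I] [DecidableEq I] in
/-- `⟨G + G'⟩ = ⟨G⟩ + ⟨G'⟩` for integrable factors. [cite: BalabanImbrieJaffe1988, §5.13 p.305] -/
theorem gexp_add {G G' : (α → ℝ) → ℝ} (hG : Integrable fun φ => G φ * (weight A φ * source f φ))
    (hG' : Integrable fun φ => G' φ * (weight A φ * source f φ)) :
    gexp A f (G + G') = gexp A f G + gexp A f G' := by
  simp only [gexp, Pi.add_apply, add_mul]
  rw [integral_add hG hG', add_div]

omit [DecidableEq α] [Fintype I] [DecidableEq I] in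
/-- `⟨a G⟩ = a ⟨G⟩`. [cite: BalabanImbrieJaffe1988, §5.13 p.305] -/
theorem gexp_smul (a : ℝ) (G : (α → ℝ) → ℝ) : gexp A f (a • G) = a * gexp A f G := by
  simp only [gexp, Pi.smul_apply, smul_eq_mul, mul_assoc]
  rw [integral_const_mul, mul_div_assoc]

omit [DecidableEq α] [Fintype I] [DecidableEq I] in
/-- `⟨Σ_i G_i⟩ = Σ_i ⟨G_i⟩` for integrable factors. [cite: BalabanImbrieJaffe1988, §5.13 p.305] -/
theorem gexp_sum {ι : Type*} (t : Finset ι) (G : ι → (α → ℝ) → ℝ)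
    (hG : ∀ i ∈ t, Integrable fun φ => G i φ * (weight A φ * source f φ)) :
    gexp A f (∑ i ∈ t, G i) = ∑ i ∈ t, gexp A f (G i) := by
  induction t using Finset.cons_induction with
  | empty =>
    simp [gexp]
  | cons i t hi ih =>
    rw [sum_cons, sum_cons, gexp_add A f (hG i (mem_cons_self i t)) ?_, ih fun j hj => hG j (mem_cons_of_mem hj)]
    have e : (fun φ => (∑ j ∈ t, G j) φ * (weight A φ * source f φ))
        = fun φ => ∑ j ∈ t, G j φ * (weight A φ * source f φ) := by
      funext φ
      rw [Finset.sum_apply, sum_mul]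
    rw [e]
    exact integrable_finsetSum t fun j hj => hG j (mem_cons_of_mem hj)

omit [Fintype I] [DecidableEq I] in
/-- A nice factor is integrable against the Gaussian measure with source. [cite: BalabanImbrieJaffe1988, §5.13 p.305] -/
theorem integrable_of_nice (hA : A.PosDef) {G : (α → ℝ) → ℝ} (hG : Nice G) :
    Integrable fun φ => G φ * (weight A φ * source f φ) := by
  obtain ⟨h1, ⟨K₀, hK₀⟩, -⟩ := hG
  have h := integrable_fieldProd_bdd_tilt hA (∅ : Finset Unit) (fun _ => (0 : α → ℝ)) f
    h1.continuous.aestronglyMeasurable hK₀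
  have e : ∀ φ : α → ℝ, weight A φ * source f φ = Real.exp (φ ⬝ᵥ f) * Real.exp (-(1/2 : ℝ) * (φ ⬝ᵥ A *ᵥ φ)) := by
    intro φ
    rw [B2Eq228Conditioning.weight, B2Eq228Conditioning.source, mul_comm]
    congr 2
    unfold dotProduct
    exact sum_congr rfl fun x _ => mul_comm _ _
  refine h.congr (Filter.Eventually.of_forall fun φ => ?_)
  simp only [prod_empty, one_mul, e]

end Gexp

/-! ## §2  Bookkeeping: tuples over `insert`, colourings of a disjoint union -/

section Bookkeeping

/-- Summing over the dependent functions on `insert a s` = over the value at `a` and the functions on `s`.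
[cite: BalabanImbrieJaffe1988, §5.13 p.306] -/
theorem sum_pi_insert {ι β M' : Type*} [DecidableEq ι] [DecidableEq β] [AddCommMonoid M'] {s : Finset ι} {a : ι}
    (ha : a ∉ s) (t : ι → Finset β) (Φ : (∀ i ∈ insert a s, β) → M') :
    ∑ q ∈ (insert a s).pi t, Φ q = ∑ b ∈ t a, ∑ q ∈ s.pi t, Φ (Pi.cons s a b q) := by
  rw [pi_insert ha, sum_biUnion]
  · refine sum_congr rfl fun b _ => ?_
    rw [sum_image fun q _ q' _ h => Pi.cons_injective ha h]
  · intro b hb b' hb' hne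
    simp only [Function.onFun]
    rw [disjoint_left]
    intro q hq hq'
    obtain ⟨g, -, rfl⟩ := mem_image.1 hq
    obtain ⟨g', -, hg'⟩ := mem_image.1 hq'
    have := congrFun (congrFun hg' a) (mem_insert_self a s)
    rw [Pi.cons_same, Pi.cons_same] at this
    exact hne this.symm

/-- The union over `insert a s` of a family evaluated at `Pi.cons`. [cite: BalabanImbrieJaffe1988, §5.13 p.306] -/
theorem biUnion_attach_insert_cons {ι β γ : Type*} [DecidableEq ι] [DecidableEq γ] {s : Finset ι} {a : ι} (ha : a ∉ s)
    (b : β) (q : ∀ i ∈ s, β) (g : ι → β → Finset γ) :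
    ((insert a s).attach.biUnion fun i => g i.1 (Pi.cons s a b q i.1 i.2))
      = g a b ∪ s.attach.biUnion fun i => g i.1 (q i.1 i.2) := by
  ext x
  simp only [mem_biUnion, mem_attach, true_and, Subtype.exists, mem_insert, mem_union]
  constructor
  · rintro ⟨i, hi, hx⟩
    rcases eq_or_ne i a with rfl | hne
    · left
      rwa [Pi.cons_same] at hx
    · right
      have hi' : i ∈ s := hi.resolve_left hne
      refine ⟨i, hi', ?_⟩
      rwa [Pi.cons_ne hne.symm] at hx
  · rintro (hx | ⟨i, hi, hx⟩)
    · exact ⟨a, Or.inl rfl, by rwa [Pi.cons_same]⟩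
    · refine ⟨i, Or.inr hi, ?_⟩
      rwa [Pi.cons_ne (fun h => ha (h ▸ hi) : a ≠ i)]

/-- `biUnion_attach_insert_cons` for the first components of a tuple of pairs.
[cite: BalabanImbrieJaffe1988, §5.13 p.306] -/
theorem biUnion_attach_insert_cons_fst {ι γ γ' : Type*} [DecidableEq ι] [DecidableEq γ] {s : Finset ι} {a : ι}
    (ha : a ∉ s) (b : Finset γ × γ') (q : ∀ i ∈ s, Finset γ × γ') :
    ((insert a s).attach.biUnion fun i => (Pi.cons s a b q i.1 i.2).1)
      = b.1 ∪ s.attach.biUnion fun i => (q i.1 i.2).1 :=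
  biUnion_attach_insert_cons ha b q fun _ p => p.1

/-- `biUnion_attach_insert_cons` for the second components of a tuple of pairs.
[cite: BalabanImbrieJaffe1988, §5.13 p.306] -/
theorem biUnion_attach_insert_cons_snd {ι γ γ' : Type*} [DecidableEq ι] [DecidableEq γ'] {s : Finset ι} {a : ι}
    (ha : a ∉ s) (b : γ × Finset γ') (q : ∀ i ∈ s, γ × Finset γ') :
    ((insert a s).attach.biUnion fun i => (Pi.cons s a b q i.1 i.2).2)
      = b.2 ∪ s.attach.biUnion fun i => (q i.1 i.2).2 :=
  biUnion_attach_insert_cons ha b q fun _ p => p.2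

variable (z₀ : Finset I → α)

/-- Glue two colourings along `X`. [cite: BalabanImbrieJaffe1988, §5.13 p.306] -/
def merge (X : Finset (Finset I)) (z₁ z₂ : Finset I → α) (b : Finset I) : α := if b ∈ X then z₁ b else z₂ b

omit [DecidableEq α] in
/-- **Colourings of a disjoint union** = pairs of colourings. [cite: BalabanImbrieJaffe1988, §5.13 p.306] -/
theorem sum_col_union {M' : Type*} [AddCommMonoid M'] {X Y : Finset (Finset I)} (hXY : Disjoint X Y)
    (F : (Finset I → α) → M') :
    ∑ z ∈ col z₀ (X ∪ Y), F z = ∑ z₁ ∈ col z₀ X, ∑ z₂ ∈ col z₀ Y, F (merge X z₁ z₂) := by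
  rw [← sum_product' (col z₀ X) (col z₀ Y) fun z₁ z₂ => F (merge X z₁ z₂)]
  refine (sum_nbij' (fun p => merge X p.1 p.2) (fun z => (merge X z z₀, merge X z₀ z)) ?_ ?_ ?_ ?_ ?_).symm
  · intro p hp
    obtain ⟨h1, h2⟩ := mem_product.1 hp
    rw [mem_col] at h1 h2 ⊢
    intro b hb
    rw [mem_union, not_or] at hb
    simp only [merge, if_neg hb.1, h2 b hb.2]
  · intro z hz
    rw [mem_col] at hz
    refine mem_product.2 ⟨(mem_col z₀).2 fun b hb => ?_, (mem_col z₀).2 fun b hb => ?_⟩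
    · simp only [merge, if_neg hb]
    · by_cases hbX : b ∈ X
      · simp only [merge, if_pos hbX]
      · simp only [merge, if_neg hbX]
        exact hz b (by rw [mem_union, not_or]; exact ⟨hbX, hb⟩)
  · intro p hp
    obtain ⟨h1, h2⟩ := mem_product.1 hp
    rw [mem_col] at h1 h2
    refine Prod.ext (funext fun b => ?_) (funext fun b => ?_)
    · by_cases hb : b ∈ X
      · simp only [merge, if_pos hb]
      · simp only [merge, if_neg hb, h1 b hb]
    · by_cases hb : b ∈ X
      · simp only [merge, if_pos hb, h2 b (disjoint_left.1 hXY hb)]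
      · simp only [merge, if_neg hb]
  · intro z _
    funext b
    by_cases hb : b ∈ X
    · simp only [merge, if_pos hb]
    · simp only [merge, if_neg hb]
  · intro p _
    rfl

omit [Fintype α] [Fintype I] [DecidableEq I] in
/-- A leg vector sees only the site of its vertex. [cite: BalabanImbrieJaffe1988, §5.13 p.306] -/
theorem lv_congr (M : Finset I → Matrix α α ℝ) {z z' : Finset I → α} {l : Leg I} (h : z l.blk = z' l.blk) :
    lv M z l = lv M z' l := by
  simp only [lv, h]

end Bookkeeping

/-! ## §3  The product of the train operators -/

section Trains

variable (f : α → ℝ) (C : Matrix α α ℝ) (N : Finset I → Matrix α α ℝ)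

/-- **The product of the train operators** of a list of groups: `(𝕋_{c₁} ∘ ⋯ ∘ 𝕋_{c_m}) G`, `𝕋_c = 𝕋_{C𝔫(c)}`.
[cite: BalabanImbrieJaffe1988, §5.13 p.306] -/
noncomputable def trains : List (Finset (Finset I)) → ((α → ℝ) → ℝ) → (α → ℝ) → ℝ
  | [], G => G
  | c :: L, G => trainOp f (C * wker C N c) (trains L G)

omit [Fintype I] in
/-- [cite: BalabanImbrieJaffe1988, §5.13 p.306] -/
@[simp] theorem trains_nil (G : (α → ℝ) → ℝ) : trains f C N [] G = G := rfl

omit [Fintype I] in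
/-- [cite: BalabanImbrieJaffe1988, §5.13 p.306] -/
@[simp] theorem trains_cons (c : Finset (Finset I)) (L : List (Finset (Finset I))) (G : (α → ℝ) → ℝ) :
    trains f C N (c :: L) G = trainOp f (C * wker C N c) (trains f C N L G) := rfl

omit [Fintype I] [DecidableEq I] in
/-- The train operator preserves a linear class of smooth factors. [cite: BalabanImbrieJaffe1988, §5.13 p.306] -/
theorem trainOp_mem {𝒞 : Submodule ℝ ((α → ℝ) → ℝ)} (h𝒞 : IsSmoothClass 𝒞) (K : Matrix α α ℝ) {G : (α → ℝ) → ℝ}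
    (hG : G ∈ 𝒞) : trainOp f K G ∈ 𝒞 := by
  have e : trainOp f K G = (fun φ => fderiv ℝ G φ (K *ᵥ f))
      + (1/2 : ℝ) • ∑ p, ∑ q, K p q • fun φ => fderiv ℝ (fun ψ => fderiv ℝ G ψ (Pi.single q 1)) φ (Pi.single p 1) := by
    funext φ
    simp only [trainOp, D2, Pi.add_apply, Pi.smul_apply, Finset.sum_apply, smul_eq_mul]
  rw [e]
  refine Submodule.add_mem 𝒞 (h𝒞.fderiv_mem G hG _) (Submodule.smul_mem 𝒞 _ (Submodule.sum_mem 𝒞 fun p _ =>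
    Submodule.sum_mem 𝒞 fun q _ => Submodule.smul_mem 𝒞 _ (h𝒞.fderiv_mem _ (h𝒞.fderiv_mem G hG _) _)))

omit [Fintype I] in
/-- The product of train operators preserves the class. [cite: BalabanImbrieJaffe1988, §5.13 p.306] -/
theorem trains_mem {𝒞 : Submodule ℝ ((α → ℝ) → ℝ)} (h𝒞 : IsSmoothClass 𝒞) (L : List (Finset (Finset I)))
    {G : (α → ℝ) → ℝ} (hG : G ∈ 𝒞) : trains f C N L G ∈ 𝒞 := by
  induction L with
  | nil => exact hG
  | cons c L ih => exact trainOp_mem f h𝒞 _ ih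

end Trains

/-! ## §4  Tuples of pieces over pairwise disjoint groups are the product of the train operators -/

section Assembly

variable (A : Matrix α α ℝ) (f : α → ℝ) (M : Finset I → Matrix α α ℝ) (z₀ : Finset I → α)

omit [Fintype α] in
/-- The legs of a piece on `c` are owned in `c` (derivative legs). [cite: BalabanImbrieJaffe1988, §5.13 p.306] -/
theorem blk_mem_of_pieces_fst {c : Finset (Finset I)} {q : Finset (Leg I) × Finset (Finset (Leg I))}
    (hq : q ∈ pieces Leg.blk c) {l : Leg I} (hl : l ∈ q.1) : l.blk ∈ c :=
  mem_plegs_univ.1 ((mem_pieces.1 hq).1 hl)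

omit [Fintype α] in
/-- The legs of a piece on `c` are owned in `c` (contracted legs). [cite: BalabanImbrieJaffe1988, §5.13 p.306] -/
theorem blk_mem_of_pieces_snd {c : Finset (Finset I)} {q : Finset (Leg I) × Finset (Finset (Leg I))}
    (hq : q ∈ pieces Leg.blk c) {B : Finset (Leg I)} (hB : B ∈ q.2) {l : Leg I} (hl : l ∈ B) : l.blk ∈ c :=
  mem_plegs_univ.1 (mem_sdiff.1 ((mem_smallParts.1 (mem_pieces.1 hq).2.2.1).1.subset hB hl)).1

omit [Fintype α] in
/-- Blocks of a piece are nonempty. [cite: BalabanImbrieJaffe1988, §5.13 p.306] -/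
theorem nonempty_of_pieces_snd {c : Finset (Finset I)} {q : Finset (Leg I) × Finset (Finset (Leg I))}
    (hq : q ∈ pieces Leg.blk c) {B : Finset (Leg I)} (hB : B ∈ q.2) : B.Nonempty :=
  (mem_smallParts.1 (mem_pieces.1 hq).2.2.1).1.nonempty_of_mem hB

omit [DecidableEq α] in
/-- `col ∅ = {z₀}`. [cite: BalabanImbrieJaffe1988, §5.13 p.306] -/
theorem col_empty : col z₀ (∅ : Finset (Finset I)) = ({z₀} : Finset (Finset I → α)) := by
  ext z
  rw [mem_col, mem_singleton]
  exact ⟨fun h => funext fun b => h b (notMem_empty b), fun h b _ => by rw [h]⟩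

/-- **TUPLES OF PIECES OVER PAIRWISE DISJOINT GROUPS, SUMMED OVER THE SITES, ARE THE PRODUCT OF THE TRAIN OPERATORS**:
for a list `L` of pairwise disjoint nonempty groups of vertices,
`Σ_{q ∈ Π_{c∈L} pieces c} Σ_{z ∈ col(⋃L)} (Π_{B ∈ ⋃_c π_c} w_B(z)) ∂_{C v(z)_{⋃_c D_c}} G = (Π_{c∈L} 𝕋_c) G`.
[cite: BalabanImbrieJaffe1988, §5.13 p.306] -/
theorem sum_pi_pieces_eq_trains {𝒞 : Submodule ℝ ((α → ℝ) → ℝ)} (h𝒞 : IsSmoothClass 𝒞) (hA : A.PosDef)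
    (L : List (Finset (Finset I))) (hL : L.Pairwise Disjoint) (hne : ∀ c ∈ L, c.Nonempty) {G : (α → ℝ) → ℝ}
    (hG : G ∈ 𝒞) :
    ∑ q ∈ L.toFinset.pi (fun c => pieces Leg.blk c), ∑ z ∈ col z₀ (L.toFinset.biUnion id),
        (∏ B ∈ L.toFinset.attach.biUnion (fun c => (q c.1 c.2).2), cweight A f (lv M z) B) •
          dset (fun l => A⁻¹ *ᵥ lv M z l) (L.toFinset.attach.biUnion fun c => (q c.1 c.2).1) G
      = trains f A⁻¹ (fun b => M b + (M b)ᵀ) L G := by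
  induction L generalizing G with
  | nil =>
    rw [trains_nil, List.toFinset_nil, Finset.pi_empty, sum_singleton, Finset.biUnion_empty, col_empty,
      sum_singleton, attach_empty, Finset.biUnion_empty, Finset.biUnion_empty, prod_empty, one_smul, dset_empty]
  | cons c L ih =>
    rw [List.pairwise_cons] at hL
    obtain ⟨hcL, hL'⟩ := hL
    have hcne : c.Nonempty := hne c List.mem_cons_self
    have hne' : ∀ c' ∈ L, c'.Nonempty := fun c' hc' => hne c' (List.mem_cons_of_mem c hc')
    have hcP : c ∉ L.toFinset := fun h =>
      hcne.ne_empty (disjoint_self.1 (hcL c (List.mem_toFinset.1 h)))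
    have hdisjσ : Disjoint c (L.toFinset.biUnion id) := by
      rw [Finset.disjoint_biUnion_right]
      exact fun c' hc' => hcL c' (List.mem_toFinset.1 hc')
    rw [trains_cons, List.toFinset_cons, sum_pi_insert hcP]
    simp only [biUnion_attach_insert_cons_fst hcP, biUnion_attach_insert_cons_snd hcP, Finset.biUnion_insert, id]
    rw [← sum_pieces_eq_trainOp A f M z₀ h𝒞 hA hcne (trains_mem f A⁻¹ _ h𝒞 L hG)]
    refine sum_congr rfl fun a ha => ?_
    -- blocks / derivative legs of the piece on `c` versus those of the other groups
    have hU₁ : ∀ q : ∀ c' ∈ L.toFinset, Finset (Leg I) × Finset (Finset (Leg I)),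
        q ∈ L.toFinset.pi (fun c => pieces Leg.blk c) →
        ∀ l ∈ L.toFinset.attach.biUnion (fun c' => (q c'.1 c'.2).1), l.blk ∉ c := by
      intro q hq l hl hlc
      obtain ⟨c', -, hl'⟩ := mem_biUnion.1 hl
      have h1 := blk_mem_of_pieces_fst (mem_pi.1 hq c'.1 c'.2) hl'
      exact disjoint_left.1 (hcL c'.1 (List.mem_toFinset.1 c'.2)) hlc h1
    have hU₂ : ∀ q : ∀ c' ∈ L.toFinset, Finset (Leg I) × Finset (Finset (Leg I)),
        q ∈ L.toFinset.pi (fun c => pieces Leg.blk c) →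
        ∀ B ∈ L.toFinset.attach.biUnion (fun c' => (q c'.1 c'.2).2), ∀ l ∈ B, l.blk ∉ c := by
      intro q hq B hB l hl hlc
      obtain ⟨c', -, hB'⟩ := mem_biUnion.1 hB
      have h1 := blk_mem_of_pieces_snd (mem_pi.1 hq c'.1 c'.2) hB' hl
      exact disjoint_left.1 (hcL c'.1 (List.mem_toFinset.1 c'.2)) hlc h1
    -- rewrite every summand
    have step : ∀ q ∈ L.toFinset.pi (fun c => pieces Leg.blk c), ∀ z₁ ∈ col z₀ c,
        ∀ z₂ ∈ col z₀ (L.toFinset.biUnion id),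
        (∏ B ∈ a.2 ∪ L.toFinset.attach.biUnion (fun c' => (q c'.1 c'.2).2),
            cweight A f (lv M (merge c z₁ z₂)) B) •
          dset (fun l => A⁻¹ *ᵥ lv M (merge c z₁ z₂) l)
            (a.1 ∪ L.toFinset.attach.biUnion fun c' => (q c'.1 c'.2).1) G
        = (∏ B ∈ a.2, cweight A f (lv M z₁) B) •
          dset (fun l => A⁻¹ *ᵥ lv M z₁ l) a.1
            ((∏ B ∈ L.toFinset.attach.biUnion (fun c' => (q c'.1 c'.2).2), cweight A f (lv M z₂) B) •
              dset (fun l => A⁻¹ *ᵥ lv M z₂ l) (L.toFinset.attach.biUnion fun c' => (q c'.1 c'.2).1) G) := by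
      intro q hq z₁ _ z₂ _
      have hm₁ : ∀ l : Leg I, l.blk ∈ c → lv M (merge c z₁ z₂) l = lv M z₁ l := fun l hl =>
        lv_congr M (by simp only [merge, if_pos hl])
      have hm₂ : ∀ l : Leg I, l.blk ∉ c → lv M (merge c z₁ z₂) l = lv M z₂ l := fun l hl =>
        lv_congr M (by simp only [merge, if_neg hl])
      have hd₁ : Disjoint a.1 (L.toFinset.attach.biUnion fun c' => (q c'.1 c'.2).1) :=
        disjoint_left.2 fun l hl hl' => hU₁ q hq l hl' (blk_mem_of_pieces_fst ha hl)
      have hd₂ : Disjoint a.2 (L.toFinset.attach.biUnion fun c' => (q c'.1 c'.2).2) := by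
        refine disjoint_left.2 fun B hB hB' => ?_
        obtain ⟨l, hl⟩ := nonempty_of_pieces_snd ha hB
        exact hU₂ q hq B hB' l hl (blk_mem_of_pieces_snd ha hB hl)
      rw [prod_union hd₂, h𝒞.dset_union _ hd₁ hG,
        prod_congr rfl fun B hB => BIJ88TrainPieces306.cweight_congr A f fun l hl =>
          hm₁ l (blk_mem_of_pieces_snd ha hB hl),
        prod_congr rfl fun B hB => BIJ88TrainPieces306.cweight_congr A f fun l hl => hm₂ l (hU₂ q hq B hB l hl),
        dset_congr (fun l hl => by rw [hm₁ l (blk_mem_of_pieces_fst ha hl)])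
          (dset (fun l => A⁻¹ *ᵥ lv M (merge c z₁ z₂) l) _ G),
        dset_congr (fun l hl => by rw [hm₂ l (hU₁ q hq l hl)]) G, mul_smul,
        h𝒞.dset_smul _ _ _ (h𝒞.dset_mem _ _ hG)]
    rw [sum_congr rfl fun q hq => sum_col_union z₀ hdisjσ _]
    rw [sum_congr rfl fun q hq => sum_congr rfl fun z₁ hz₁ => sum_congr rfl fun z₂ hz₂ => step q hq z₁ hz₁ z₂ hz₂]
    -- reorder the sums and use linearity of `∂_{u_{D_c}}` and the induction hypothesis
    rw [sum_comm]
    refine sum_congr rfl fun z₁ _ => ?_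
    have hmem : ∀ q ∈ L.toFinset.pi (fun c => pieces Leg.blk c), ∀ z₂ ∈ col z₀ (L.toFinset.biUnion id),
        ((∏ B ∈ L.toFinset.attach.biUnion (fun c' => (q c'.1 c'.2).2), cweight A f (lv M z₂) B) •
          dset (fun l => A⁻¹ *ᵥ lv M z₂ l) (L.toFinset.attach.biUnion fun c' => (q c'.1 c'.2).1) G) ∈ 𝒞 :=
      fun q _ z₂ _ => Submodule.smul_mem 𝒞 _ (h𝒞.dset_mem _ _ hG)
    rw [← ih hL' hne' hG, h𝒞.dset_sum _ _ _ _ fun q hq => Submodule.sum_mem 𝒞 fun z₂ hz₂ => hmem q hq z₂ hz₂,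
      smul_sum]
    refine sum_congr rfl fun q hq => ?_
    rw [h𝒞.dset_sum _ _ _ _ fun z₂ hz₂ => hmem q hq z₂ hz₂, smul_sum]

end Assembly

/-! ## §5  (5.13.3) at every order -/

section Main

variable (blk : α → I) {Δ : Matrix α α ℝ} (hΔ : Δ.PosDef) {c C : ℝ} (hc : 0 < c)
  (hcΔ : ∀ v, c * (v ⬝ᵥ v) ≤ v ⬝ᵥ (Δ *ᵥ v)) (hCΔ : ∀ v, v ⬝ᵥ (Δ *ᵥ v) ≤ C * (v ⬝ᵥ v))
  {s : I → ℝ} (hs : ∀ l, 0 ≤ s l ∧ s l ≤ 1) (f : α → ℝ)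
  (𝒞 : ((α → ℝ) → ℝ) → Prop)
  (hC : ∀ G, 𝒞 G → ContDiff ℝ 1 G ∧ (∃ K₀ : ℝ, ∀ φ, ‖G φ‖ ≤ K₀) ∧ ∃ K₁ : ℝ, ∀ φ, ‖fderiv ℝ G φ‖ ≤ K₁)
  (hD : ∀ G (u : α → ℝ), 𝒞 G → 𝒞 (fun φ => fderiv ℝ G φ u)) {H : (α → ℝ) → ℝ} (hH : 𝒞 H)
  (z₀ : Finset I → α)

include hΔ hc hcΔ hCΔ hs hC hD hH z₀ in
/-- **(5.13.3) IN INTEGRAND FORM — THE WALK FORM OF `∂/∂s_Γ⟨H⟩_s` AFTER THE COMPLETE INTEGRATION BY PARTS, AT EVERY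
ORDER** (corrected form, G-C2-24; editorial: the printed (5.13.3) is the integrated equation
`⟨Π_{i∈I} f(□_i)⟩_1 = Σ_{Γ⊂I} ∫ds_Γ Σ_{π∈𝒫(Γ)} ⟨…⟩_{s_Γ}`, this theorem is the identity for its integrand at a fixed
`s`): the `Γ`-fold `s`-derivative of the normalized expectation of the smooth factor `H` in the interpolated Gaussian
measure is the signed sum over the set partitions `σ` of `Γ` into vertices (blocks of one or two cubes), over the set
partitions `P` of the vertex set into groups (*«an element of a partition π of Γ. Thus letting 𝒫(Γ) denote the
partitions of Γ»*), of the expectation of the product over the groups `c ∈ P` of THE TRAIN OPERATORS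
`𝕋_c = ∂_{C_s𝔫(c)ℱ} + ½ Σ_{pq} (C_s𝔫(c))_{pq} ∂_p∂_q` applied to `H`,
`C_s𝔫(c) = Σ_{walks (b₁,…,b_k) through c} C_s N_{b₁} C_s ⋯ N_{b_k} C_s` (*print: «Σ_{ω(α)} ⟨δ/δΦ, C_s □_{i₁} Δ □_{i₂}
C_s □_{i₃} Δ □_{i₄} … Δ □_{i_{|ω(α)|}} C_s (½ δ/δΦ + ℱ)⟩», «The 1/2 for the δ²/δΦ² term compensates for the fact that we
count a walk as being different from its reverse»*; the vertices `□Δ□` replaced by the corrected vertices `N_b`):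
`∂Γ⟨H⟩(s) = Σ_{σ ∈ smallParts Γ} (−1)^{|σ|} Σ_{P ∈ setPartitions σ} ⟨(Π_{c∈P} 𝕋_c) H⟩_s`.
[cite: BalabanImbrieJaffe1988, §5.13 Eq. (5.13.3) p.306] -/
theorem dexp_eq_sum_trains (Γ : Finset I) :
    dexp blk Δ f H Γ s
      = ∑ σ ∈ smallParts Γ, (-1 : ℝ) ^ σ.card *
          ∑ P ∈ setPartitions σ, gexp (interpForm blk Δ s) f
            (trains f (interpForm blk Δ s)⁻¹ (fun b => bmat blk Δ s b + (bmat blk Δ s b)ᵀ) P.toList H) := by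
  -- the class of smooth factors, as a subspace
  have h𝒞 : IsSmoothClass (Submodule.span ℝ {G | 𝒞 G}) := isSmoothClass_span 𝒞 hC hD
  have hH' : H ∈ Submodule.span ℝ {G | 𝒞 G} := Submodule.subset_span hH
  have hA : (interpForm blk Δ s).PosDef := interpForm_posDef blk hΔ hs
  rw [dexp_eq_sum_connected blk hΔ hc hcΔ hCΔ hs f 𝒞 hC hD hH z₀ Γ]
  refine sum_congr rfl fun σ _ => ?_
  congr 1
  rw [piFinset_colours_eq_col z₀ σ, sum_comm]
  -- the summand as a function of the diagram `(D, τ)`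
  have hdval : ∀ (g : Finset (Leg I) × Finset (Finset (Leg I))) (z : Finset I → α),
      dval (gw (interpForm blk Δ s) f (lvec blk Δ s z)) (gω (interpForm blk Δ s) f (lvec blk Δ s z) H)
          (insertNone σ) g
        = (∏ B ∈ g.2, gw (interpForm blk Δ s) f (lv (bmat blk Δ s) z) B) *
          gexp (interpForm blk Δ s) f (dset (fun l => (interpForm blk Δ s)⁻¹ *ᵥ lv (bmat blk Δ s) z l) g.1 H) := by
    intro g z
    rw [dval, if_pos none_mem_insertNone, gω, lvec_eq_lv]
  rw [sum_congr rfl fun g _ => sum_congr rfl fun z _ => hdval g z]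
  -- regroup the connected diagrams by their trains
  rw [sum_conn_eq_sum_pieces σ (fun D τ => ∑ z ∈ col z₀ σ,
      (∏ B ∈ τ, gw (interpForm blk Δ s) f (lv (bmat blk Δ s) z) B) *
        gexp (interpForm blk Δ s) f (dset (fun l => (interpForm blk Δ s)⁻¹ *ᵥ lv (bmat blk Δ s) z l) D H))
      fun D τ _ hbig => sum_eq_zero fun z _ => by
        rw [prod_gw_eq_zero _ _ _ (fun hall => by obtain ⟨B, hB, hBc⟩ := hbig; exact (not_le.2 hBc) (hall B hB)),
          zero_mul]]
  refine sum_congr rfl fun P hP => ?_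
  have hPP : IsSetPartition σ P := mem_setPartitions.1 hP
  -- the tuples of pieces over `P`, enumerated along `P.toList`
  have hpw : P.toList.Pairwise Disjoint := (nodup_toList P).pairwise_of_forall_ne
    fun a ha b hb hab => hPP.disjoint (mem_toList.1 ha) (mem_toList.1 hb) hab
  have hne : ∀ c ∈ P.toList, c.Nonempty := fun c hc => hPP.nonempty_of_mem (mem_toList.1 hc)
  have key := sum_pi_pieces_eq_trains (interpForm blk Δ s) f (bmat blk Δ s) z₀ h𝒞 hA P.toList hpw hne hH'
  rw [toList_toFinset, hPP.biUnion_id] at key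
  rw [← key]
  -- blocks of pieces are small: `gw = cweight`
  have hsmall : ∀ q ∈ P.pi (fun c => pieces Leg.blk c), ∀ B ∈ P.attach.biUnion (fun c => (q c.1 c.2).2),
      B.card ≤ 2 := by
    intro q hq B hB
    obtain ⟨c', -, hB'⟩ := mem_biUnion.1 hB
    exact (mem_smallParts.1 (mem_pieces.1 (mem_pi.1 hq c'.1 c'.2)).2.2.1).2 B hB'
  rw [sum_congr rfl fun q hq => sum_congr rfl fun z _ => by rw [prod_gw_eq _ _ _ (hsmall q hq)]]
  -- linearity of the normalized expectation
  have hmem : ∀ (q : ∀ c ∈ P, Finset (Leg I) × Finset (Finset (Leg I))) (z : Finset I → α),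
      ((∏ B ∈ P.attach.biUnion (fun c => (q c.1 c.2).2), cweight (interpForm blk Δ s) f (lv (bmat blk Δ s) z) B) •
        dset (fun l => (interpForm blk Δ s)⁻¹ *ᵥ lv (bmat blk Δ s) z l)
          (P.attach.biUnion fun c => (q c.1 c.2).1) H) ∈ Submodule.span ℝ {G | 𝒞 G} :=
    fun q z => Submodule.smul_mem _ _ (h𝒞.dset_mem _ _ hH')
  rw [gexp_sum _ _ _ _ fun q _ => integrable_of_nice _ f hA (h𝒞.nice _ (Submodule.sum_mem _ fun z _ => hmem q z))]
  refine sum_congr rfl fun q _ => ?_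
  rw [gexp_sum _ _ _ _ fun z _ => integrable_of_nice _ f hA (h𝒞.nice _ (hmem q z))]
  exact sum_congr rfl fun z _ => (gexp_smul _ f _ _).symm

end Main

end Literature.MathematicalPhysics.QuantumFieldTheory.BalabanImbrieJaffe1984to88.BIJ88WalkForm5133
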